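import Literature.NumberTheory.ComplexMultiplication.CMOrderPEquivalenceLocalColon
import Literature.NumberTheory.ComplexMultiplication.CMOrderGorenstein
import HarnessLib

/-!
# Gorenstein prime by prime (MARSEGLIA 2019 REMARK 5.5): if the trace dual `Sᵗ` of an over-order `S` is locally
# principal at `𝔭`, `Sᵗ_𝔭 = x·S_𝔭`, then every `I` with `(I:I) = S` is `𝔭`-equivalent to `S` —
# `1 ∈ ((I:S)(S:I))_𝔭` — and `Sᵗ` locally principal at every `𝔭 ⊇ 𝔣` makes `W̄k(S)` trivial

Family `hodge`, lane `lit-hodgefound` (Track 2 foundations library; seat p15, row g26-#17), topic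
`Literature/NumberTheory/ComplexMultiplication`, namespace `Literature.NumberTheory.ComplexMultiplication.CMTypeLattice` (the
order `𝔯 = endOrder (M_μ)` of a number field of any degree, trace duals as in `CMOrderGorenstein`: `↑TS = traceDual ℤ ℚ ↑MS`
says «`TS = Sᵗ`»).  THEOREMS ONLY: no definition, no instance, no named fact (net Literature debt `0`).  Vocabulary:
`(I:J) = I / J`; an over-order is an idempotent `MS = MS·MS ≠ 0`; «`(I:I) = S`» is `I / I = MS`; `R_𝔭 =
Localization.subalgebra.ofField K 𝔭.primeCompl _`, `N_𝔭 = span R_𝔭 ↑N`; «locally principal at `𝔭`» is `Sᵗ_𝔭 = R_𝔭x·S_𝔭`;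
«`𝔭`-equivalent» (Marseglia 2025 Prop. 3.2 (4)) is `1 ∈ (I:J)(J:I) + 𝔭`.

## Source, VERBATIM

S. Marseglia, *Computing the ideal class monoid of an order*, J. Lond. Math. Soc. (2) 101 (2020) 984–1007
[Marseglia2019] (arXiv:1805.09671, held `paper:arxiv-1805.09671`, chunk p0011): "Remark 5.5. Let `𝔭_i` be one the
primes appearing in (5.1). If the `S/𝔭_i`-vector space `S^t/𝔭_iS^t` is one-dimensional, then by Nakayama's Lemma we have
that `S^t` is locally principal at `𝔭_i`. It follows that each fractional ideal `I` with multiplicator ring `S`, that is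
`II^t = S^t`, will be locally invertible at `𝔭_i`, or, in other words, `W̄k(S_{𝔭_i})` is trivial."
(The Nakayama step is not formalised: «`S^t` locally principal at `𝔭`» is the hypothesis here, `𝔭` a prime of `𝔯`.)

## What is formalised

* **`mul_mul_div_le_div_mul_div`** (`IIᵗ·(S:Sᵗ) = Sᵗ(S:Sᵗ) ⊆ (I:S)(S:I)` for `(I:I) = S`, using `IIᵗ = Sᵗ`, Lemma 2.3),
  **`one_mem_span_coe_mul_div_of_span_coe_eq`** (`Sᵗ_𝔭 = xS_𝔭 ⟹ 1 ∈ (Sᵗ(S:Sᵗ))_𝔭`),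
  **`one_mem_span_coe_div_mul_div_of_span_coe_traceDual_eq`** (REMARK 5.5: `1 ∈ ((I:S)(S:I))_𝔭`),
  **`one_mem_div_mul_div_add_coeIdeal_of_span_coe_traceDual_eq`** (maximal `𝔭`: `I` and `S` are `𝔭`-equivalent),
  **`one_mem_div_mul_div_of_forall_span_coe_traceDual_eq`** (`Sᵗ` locally principal at every maximal `𝔭` ⟹ `1 ∈ (I:S)(S:I)`:
  `I` is weakly equivalent to `S`, i.e. `W̄k(S) = {[S]}`).
-/

noncomputable section

open scoped nonZeroDivisors NumberField
open NumberField Module FractionalIdeal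
open Submodule (traceDual)

namespace Literature.NumberTheory.ComplexMultiplication

namespace CMTypeLattice

variable {K : Type} [Field K] [NumberField K]
variable {ι : Type} [Fintype ι] [DecidableEq ι] [Nonempty ι] (μ : Basis ι ℚ K)
variable [IsFractionRing (endOrder (Algebra.leftMulMatrix μ)) K]

omit [Nonempty ι] in
/-- **`Sᵗ·(S:Sᵗ) ⊆ (I:S)(S:I)` for every `I` with `(I:I) = S`**: `IIᵗ = Sᵗ` (Lemma 2.3), `I ⊆ (I:S)` and
`Iᵗ(S:Sᵗ) ⊆ (S:I)` (`yz·I ⊆ z·IᵗI = z·Sᵗ ⊆ S`). [cite: Marseglia2019, §5 Remark 5.5 («`II^t = S^t`»), p. 11; §2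
Lemma 2.3 («`S = (I:I) ⟺ II^t = S^t`»), p. 4] -/
theorem mul_mul_div_le_div_mul_div {I MS TS : FractionalIdeal (endOrder (Algebra.leftMulMatrix μ))⁰ K} (hI : I ≠ 0)
    (hS0 : MS ≠ 0) (hTS0 : TS ≠ 0) (hIS : I / I = MS)
    (hTS : (TS : Submodule (endOrder (Algebra.leftMulMatrix μ)) K) =
      traceDual ℤ ℚ (MS : Submodule (endOrder (Algebra.leftMulMatrix μ)) K)) :
    TS * (MS / TS) ≤ I / MS * (MS / I) := by
  obtain ⟨TI, hTI0, hTI⟩ := exists_coe_eq_traceDual μ hI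
  have hITI : I * TI = TS := (div_self_eq_iff_mul_traceDual_eq μ hI hTI0 hS0 hTI hTS).1 hIS
  have hSI : MS * I = I := by rw [← hIS, EndOrder.div_self_mul_self_eq hI]
  -- `I ⊆ (I:S)` and `Iᵗ(S:Sᵗ) ⊆ (S:I)`
  have h1 : I ≤ I / MS := (le_div_iff_mul_le hS0).2 (by rw [mul_comm, hSI])
  have h2 : TI * (MS / TS) ≤ MS / I := (le_div_iff_mul_le hI).2 (by
    rw [mul_right_comm, mul_comm TI I, hITI, mul_comm]
    exact (le_div_iff_mul_le hTS0).1 le_rfl)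
  calc TS * (MS / TS) = I * (TI * (MS / TS)) := by rw [← mul_assoc, hITI]
    _ ≤ I / MS * (MS / I) := mul_le_mul' h1 h2

/-- **`Sᵗ_𝔭 = x·S_𝔭 ⟹ 1 ∈ (Sᵗ(S:Sᵗ))_𝔭`**: `(Sᵗ(S:Sᵗ))_𝔭 = xS_𝔭·(S_𝔭 : xS_𝔭) = xS_𝔭·x⁻¹(S_𝔭:S_𝔭) ∋ 1`.
[cite: Marseglia2019, §5 Remark 5.5 («`S^t` is locally principal at `𝔭_i`»), p. 11; §4, proof of Prop. 4.1
(«`(J_𝔭 : xJ_𝔭) = (1/x)(J_𝔭:J_𝔭)`»), p. 8] -/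
theorem one_mem_span_coe_mul_div_of_span_coe_eq {MS TS : FractionalIdeal (endOrder (Algebra.leftMulMatrix μ))⁰ K}
    (hS1 : (1 : K) ∈ MS) (hTS0 : TS ≠ 0) (𝔭 : Ideal (endOrder (Algebra.leftMulMatrix μ))) [𝔭.IsPrime] {x : K}
    (hx : Submodule.span (Localization.subalgebra.ofField K 𝔭.primeCompl 𝔭.primeCompl_le_nonZeroDivisors) (TS : Set K) =
      Submodule.span (Localization.subalgebra.ofField K 𝔭.primeCompl 𝔭.primeCompl_le_nonZeroDivisors) {x} *
        Submodule.span (Localization.subalgebra.ofField K 𝔭.primeCompl 𝔭.primeCompl_le_nonZeroDivisors) (MS : Set K)) :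
    (1 : K) ∈ Submodule.span (Localization.subalgebra.ofField K 𝔭.primeCompl 𝔭.primeCompl_le_nonZeroDivisors)
      ((TS * (MS / TS) : FractionalIdeal (endOrder (Algebra.leftMulMatrix μ))⁰ K) : Set K) := by
  haveI := isNoetherianRing_endOrder (Algebra.leftMulMatrix μ)
  set A := Localization.subalgebra.ofField K 𝔭.primeCompl 𝔭.primeCompl_le_nonZeroDivisors with hA
  have hx0 : x ≠ 0 := NumberRing.ne_zero_of_span_coe_eq_span_singleton_mul hTS0 𝔭 hx
  have hS1' : (1 : K) ∈ Submodule.span A (MS : Set K) := Submodule.subset_span hS1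
  rw [NumberRing.span_coe_mul, NumberRing.span_coe_div hTS0, hx, NumberRing.div_span_singleton_mul A hx0,
    ← mul_inv_cancel₀ hx0]
  have h1 : x ∈ Submodule.span A {x} * Submodule.span A (MS : Set K) := by
    have h := Submodule.mul_mem_mul (Submodule.mem_span_singleton_self x) hS1'
    rwa [mul_one] at h
  have h2 : x⁻¹ ∈ Submodule.span A {x⁻¹} * (Submodule.span A (MS : Set K) / Submodule.span A (MS : Set K)) := by
    have h11 : (1 : K) ∈ Submodule.span A (MS : Set K) / Submodule.span A (MS : Set K) :=
      Submodule.mem_div_iff_forall_mul_mem.2 fun y hy ↦ by rwa [one_mul]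
    have h := Submodule.mul_mem_mul (Submodule.mem_span_singleton_self x⁻¹) h11
    rwa [mul_one] at h
  exact Submodule.mul_mem_mul h1 h2

/-- **REMARK 5.5: if `Sᵗ` is locally principal at `𝔭` then every `I` with multiplicator ring `S` is locally
equivalent to `S` at `𝔭` — `1 ∈ ((I:S)(S:I))_𝔭`** («each fractional ideal `I` with multiplicator ring `S`, that is
`II^t = S^t`, will be locally invertible at `𝔭_i`»). [cite: Marseglia2019, §5 Remark 5.5, p. 11] -/
theorem one_mem_span_coe_div_mul_div_of_span_coe_traceDual_eq {I MS TS : FractionalIdeal (endOrder (Algebra.leftMulMatrix μ))⁰ K}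
    (hSS : MS * MS = MS) (hS0 : MS ≠ 0) (hI : I ≠ 0) (hIS : I / I = MS)
    (hTS : (TS : Submodule (endOrder (Algebra.leftMulMatrix μ)) K) =
      traceDual ℤ ℚ (MS : Submodule (endOrder (Algebra.leftMulMatrix μ)) K))
    (𝔭 : Ideal (endOrder (Algebra.leftMulMatrix μ))) [𝔭.IsPrime] {x : K}
    (hx : Submodule.span (Localization.subalgebra.ofField K 𝔭.primeCompl 𝔭.primeCompl_le_nonZeroDivisors) (TS : Set K) =
      Submodule.span (Localization.subalgebra.ofField K 𝔭.primeCompl 𝔭.primeCompl_le_nonZeroDivisors) {x} *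
        Submodule.span (Localization.subalgebra.ofField K 𝔭.primeCompl 𝔭.primeCompl_le_nonZeroDivisors) (MS : Set K)) :
    (1 : K) ∈ Submodule.span (Localization.subalgebra.ofField K 𝔭.primeCompl 𝔭.primeCompl_le_nonZeroDivisors)
      ((I / MS * (MS / I) : FractionalIdeal (endOrder (Algebra.leftMulMatrix μ))⁰ K) : Set K) := by
  -- `TS ≠ 0`
  obtain ⟨T', hT'0, hT'⟩ := exists_coe_eq_traceDual μ hS0
  have hTT' : T' = TS := coeToSubmodule_inj.1 (hT'.trans hTS.symm)
  subst hTT'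
  exact Submodule.span_mono (fun y hy ↦ mul_mul_div_le_div_mul_div μ hI hS0 hT'0 hIS hT' hy)
    (one_mem_span_coe_mul_div_of_span_coe_eq μ (FractionalIdeal.one_le.1 (EndOrder.one_le_of_mul_self_eq hSS hS0))
      hT'0 𝔭 hx)

/-- **REMARK 5.5 at a maximal `𝔭`: `Sᵗ_𝔭 = xS_𝔭` ⟹ `I` and `S` are `𝔭`-equivalent, `1 ∈ (I:S)(S:I) + 𝔭`** (Marseglia
2025 Prop. 3.2 (4)). [cite: Marseglia2019, §5 Remark 5.5, p. 11] [cite: Marseglia2025LocalIsomorphism, §3 Prop. 3.2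
((3) ⟺ (4)), p. 6] -/
theorem one_mem_div_mul_div_add_coeIdeal_of_span_coe_traceDual_eq {I MS TS : FractionalIdeal (endOrder (Algebra.leftMulMatrix μ))⁰ K}
    (hSS : MS * MS = MS) (hS0 : MS ≠ 0) (hI : I ≠ 0) (hIS : I / I = MS)
    (hTS : (TS : Submodule (endOrder (Algebra.leftMulMatrix μ)) K) =
      traceDual ℤ ℚ (MS : Submodule (endOrder (Algebra.leftMulMatrix μ)) K))
    (𝔭 : Ideal (endOrder (Algebra.leftMulMatrix μ))) [𝔭.IsMaximal] {x : K}
    (hx : Submodule.span (Localization.subalgebra.ofField K 𝔭.primeCompl 𝔭.primeCompl_le_nonZeroDivisors) (TS : Set K) =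
      Submodule.span (Localization.subalgebra.ofField K 𝔭.primeCompl 𝔭.primeCompl_le_nonZeroDivisors) {x} *
        Submodule.span (Localization.subalgebra.ofField K 𝔭.primeCompl 𝔭.primeCompl_le_nonZeroDivisors) (MS : Set K)) :
    (1 : K) ∈ I / MS * (MS / I) + (𝔭 : FractionalIdeal (endOrder (Algebra.leftMulMatrix μ))⁰ K) :=
  (NumberRing.one_mem_span_coe_iff_one_mem_add_coeIdeal _ 𝔭).1
    (one_mem_span_coe_div_mul_div_of_span_coe_traceDual_eq μ hSS hS0 hI hIS hTS 𝔭 hx)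

/-- **`Sᵗ` locally principal at every maximal `𝔭` ⟹ every `I` with `(I:I) = S` is weakly equivalent to `S`:
`1 ∈ (I:S)(S:I)`** («in other words, `W̄k(S_𝔭)` is trivial», at all `𝔭`; then (4-3)). [cite: Marseglia2019, §5
Remark 5.5, p. 11; §4 Prop. 4.1 ((1) ⟹ (2)), p. 8] -/
theorem one_mem_div_mul_div_of_forall_span_coe_traceDual_eq {I MS TS : FractionalIdeal (endOrder (Algebra.leftMulMatrix μ))⁰ K}
    (hSS : MS * MS = MS) (hS0 : MS ≠ 0) (hI : I ≠ 0) (hIS : I / I = MS)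
    (hTS : (TS : Submodule (endOrder (Algebra.leftMulMatrix μ)) K) =
      traceDual ℤ ℚ (MS : Submodule (endOrder (Algebra.leftMulMatrix μ)) K))
    (h : ∀ 𝔭 : MaximalSpectrum (endOrder (Algebra.leftMulMatrix μ)), ∃ x : K,
      Submodule.span (Localization.subalgebra.ofField K 𝔭.asIdeal.primeCompl 𝔭.asIdeal.primeCompl_le_nonZeroDivisors)
          (TS : Set K) =
        Submodule.span (Localization.subalgebra.ofField K 𝔭.asIdeal.primeCompl 𝔭.asIdeal.primeCompl_le_nonZeroDivisors)
            {x} *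
          Submodule.span (Localization.subalgebra.ofField K 𝔭.asIdeal.primeCompl
            𝔭.asIdeal.primeCompl_le_nonZeroDivisors) (MS : Set K)) :
    (1 : K) ∈ I / MS * (MS / I) := by
  rw [← mem_coe, NumberRing.mem_iff_forall_mem_span]
  intro 𝔭
  rw [coeToSet_coeToSubmodule]
  haveI := 𝔭.isMaximal.isPrime
  obtain ⟨x, hx⟩ := h 𝔭
  exact one_mem_span_coe_div_mul_div_of_span_coe_traceDual_eq μ hSS hS0 hI hIS hTS 𝔭.asIdeal hx

end CMTypeLattice

end Literature.NumberTheory.ComplexMultiplication
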